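import Summits.NavierStokesRegularity.NavierStokesRegularity.Theses.RellichScar
import Summits.NavierStokesRegularity.NavierStokesRegularity.Theorems.ScarRigidity.Negative.LogicAndLoadBearing
import Summits.NavierStokesRegularity.NavierStokesRegularity.Theorems.RellichScarDefs
import Summits.NavierStokesRegularity.NavierStokesRegularity.Theorems.RellichScarScarRigidityApexMild
import Summits.NavierStokesRegularity.NavierStokesRegularity.Theorems.RellichScarScarRigidityApexRegularity
import Summits.NavierStokesRegularity.NavierStokesRegularity.Theorems.RellichScarScarRigidityApexRegularityExchange
import Summits.NavierStokesRegularity.NavierStokesRegularity.Theorems.RellichScarScarRigidityMomentLadderReduction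
import Summits.NavierStokesRegularity.NavierStokesRegularity.Theorems.RellichScarSelfSimilarApexFatal
import Summits.NavierStokesRegularity.NavierStokesRegularity.Theorems.RellichScarAxisymmetricApexFatal
import Summits.NavierStokesRegularity.NavierStokesRegularity.Theorems.RellichScarSimilarityCovariance
import Summits.NavierStokesRegularity.NavierStokesRegularity.Theorems.RellichScarScarRigidityGeneratorHullGlue
import Summits.NavierStokesRegularity.NavierStokesRegularity.Theorems.RellichScarScarRigidityDilationGeneratorFlat
import Summits.NavierStokesRegularity.NavierStokesRegularity.Theorems.RellichScarScarRigidityRotationGeneratorFlat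
import Summits.NavierStokesRegularity.NavierStokesRegularity.Theorems.RellichScarScarRigidityRotationOrbitIncrement
import Summits.NavierStokesRegularity.NavierStokesRegularity.Theorems.RellichScarScarRigidityRotationGeneratorLinearised
import Summits.NavierStokesRegularity.NavierStokesRegularity.Theorems.RellichScarScarRigidityScalingGeneratorLinearised
import Summits.NavierStokesRegularity.NavierStokesRegularity.Theorems.RellichScarScarRigiditySelfSimilarOfGeneratorZero
import Literature.Analysis.FluidPDE.TypeIAncientMild
import Literature.Analysis.FluidPDE.SwirlTransportProofs
import HarnessLib

/-!
# `ScarRigidity` — line `SketchIdeator6` (generator–hull), the LINEAR REDUCTION: scar rigidity from X-Liouville for the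
# exact linearisation at a true profile (crux stmt-NavierStokesRegularity-11717, route RellichScar; lead a3)

Sorry-free.  The second route of the line (skeleton v2), with its open core as a HYPOTHESIS.  Linear rigidity (LR): at a
singular smooth apex profile `(V,Q)` every jointly smooth divergence-free solution `(Z,P)` of the linearised Navier–Stokes
system `∂ₜZ + (V·∇)Z + (Z·∇)V = ΔZ − ∇P` on the whole backward slab with finite scale-invariant weighted norm
`‖Z(t,x)‖ ≤ K(−t)/(‖x‖+√(−t))³` vanishes.

* `noAxisymmetricScarProfile_of_linearRigidity` — LR ⇒ no singular apex profile of the route's class has an axisymmetric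
  scar: the rotation generator `J V − ∇V·(Jx)` is in the weighted class (`stub_rotationGeneratorFlat`, p130364), solves
  the linearised system (`stub_rotationGeneratorSolvesLinearised`, p131411), so LR kills it; a vanishing rotation generator
  freezes the rotation orbit (`stub_rotationOrbitIncrement` with `K = 0`, p129583) and `AxisymmetricApexFatal` ends it.
* `noHomogeneousScarProfile_of_linearRigidity` — LR ⇒ no homogeneous scar: the scaling generator `V + x·∇V + 2t∂ₜV` is in
  the weighted class (`stub_dilationGeneratorFlat` p129707 + the package bound on `∂ₜV`), solves the linearised system
  (`stub_scalingGeneratorSolvesLinearised`, p131414), LR kills it, `stub_selfSimilar_of_scalingGeneratorZero` (p131062) makes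
  the profile exactly self-similar, `SelfSimilarApexFatal` ends it.
* `scarRigidity_of_symmetricScarExists_of_linearRigidity` — `ScarRigidity` from `SymmetricScarExists` (item 11718, hypothesis)
  and LR (pure logic via `exists_singular_apex_of_not_scarRigidity`).

Companion of `…GeneratorHullReduction.lean` (the isolation route).  Closes with the registered tools stub
`stub_linearRigidityReduction`.
-/

noncomputable section

open Set Filter Function MeasureTheory Metric TopologicalSpace
open scoped Topology ENNReal NNReal InnerProductSpace RealInnerProductSpace ContDiff Laplacian

set_option linter.dupNamespace false -- D-0017: `Summit.<S>.<S>.…` repeats the summit name by design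

namespace Summit.NavierStokesRegularity.NavierStokesRegularity.Theorems.RellichScarScarRigidity

open Literature.Analysis.FluidPDE
open Summit.NavierStokesRegularity.NavierStokesRegularity.Theses.RellichScar
open Summit.NavierStokesRegularity.NavierStokesRegularity.Theorems.ScarRigidity.Negative
open MomentLadder GeneratorHull

/-- Physical space. -/
local notation "ℝ³" => EuclideanSpace ℝ (Fin 3)

/-- The open backward slab `(-∞,0) × ℝ³`. -/
local notation "𝕊" => Literature.Analysis.FluidPDE.slab (EuclideanSpace ℝ (Fin 3)) (Set.Iio (0 : ℝ)) isOpen_Iio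

/-! ## The reduction -/

/-- **No singular apex profile has an axisymmetric scar — from linear rigidity.**  Smooth representative `V` with package
`Q`; the axisymmetric scar makes the rotation generator `r` finite in the weighted norm (`stub_rotationGeneratorFlat`,
landed); `r` solves the linearised system (`stub_rotationGeneratorSolvesLinearised`); linear rigidity kills it; a vanishing
rotation generator freezes the rotation orbit (`stub_rotationOrbitIncrement` with `K = 0`, landed); the profile is then a.e.
axisymmetric and `AxisymmetricApexFatal` (Seregin–Šverák 2009, landed) ends it. -/
theorem noAxisymmetricScarProfile_of_linearRigidity (stub_linearRigidityAtProfile :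
    (∀ (V : ℝ → ℝ³ → ℝ³) (Q : ℝ → ℝ³ → ℝ) (C : ℝ), 0 < C →
        IsTypeIAncientMild C V → HasTypeIDecay C V → IsClassicalNSSolutionOn (Iio (0 : ℝ)) 1 0 V Q →
        ScaleInvariantBounds V Q → IsBackwardSingularPoint V 0 →
        ∀ (Z : ℝ → ℝ³ → ℝ³) (P : ℝ → ℝ³ → ℝ) (K : ℝ),
          IsSmoothSpaceTimeOn (Iio (0 : ℝ)) Z → IsSmoothSpaceTimeOn (Iio (0 : ℝ)) P →
          (∀ t < 0, VectorCalculus.IsDivFree (Z t)) →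
          (∀ t < 0, ∀ x : ℝ³, deriv (fun s => Z s x) t + convect (V t) (Z t) x + convect (Z t) (V t) x =
              (Δ (Z t)) x - gradient (P t) x) →
          (∀ t < 0, ∀ x : ℝ³, ‖Z t x‖ ≤ K * ((-t) / (‖x‖ + Real.sqrt (-t)) ^ 3)) →
          ∀ t < 0, ∀ x : ℝ³, Z t x = 0)) :
    ∀ (u : ℝ → ℝ³ → ℝ³) (p : ℝ → ℝ³ → ℝ) (G : ℝ → ℝ³ → ℝ³ →L[ℝ] ℝ³) (C : ℝ),
      IsSuitableWeakSolutionOn 𝕊 1 0 u p → HasWeakSpatialGradientOn 𝕊 u G →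
      typeIBound (Iio (0 : ℝ) ×ˢ univ) u p G < ⊤ → HasTypeIDecay C u → IsBackwardSingularPoint u 0 →
      (∀ θ : ℝ, SameScar (fun t x => rotZ θ (u t (rotZ (-θ) x))) u) → False := by
  intro u p G C hs hg hI hd hsing hax
  have hC : 0 < C := pos_const_of_apexSingular hd hsing
  obtain ⟨V, hae, hm, hdV⟩ := stub_apexMildRepresentative u p G C hC hs hg hI hd
  obtain ⟨Q, hcl, hB⟩ := stub_apexRegularity V C hC hm hdV
  have hsV : IsBackwardSingularPoint V 0 := isBackwardSingularPoint_congr_ae hae hsing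
  have haxV : ∀ θ : ℝ, SameScar (fun t x => rotZ θ (V t (rotZ (-θ) x))) V := fun θ =>
    sameScar_congr_ae (ae_conj_congr hae θ) hae (hax θ)
  -- the rotation generator is in X, solves the linearised system, hence vanishes
  obtain ⟨K, hK⟩ := stub_rotationGeneratorFlat V Q C hC hm hdV hcl hB haxV
  obtain ⟨hZs, hPs, hdiv, heq⟩ := stub_rotationGeneratorSolvesLinearised V Q hcl
  have hr0 := stub_linearRigidityAtProfile V Q C hC hm hdV hcl hB hsV _ _ K hZs hPs hdiv heq hK
  -- frozen rotation orbit
  have hK0 : ∀ t < 0, ∀ x : ℝ³,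
      ‖rotGen (V t x) - fderiv ℝ (V t) x (rotGen x)‖ ≤ 0 * ((-t) / (‖x‖ + Real.sqrt (-t)) ^ 3) := by
    intro t ht x
    rw [hr0 t ht x, norm_zero, zero_mul]
  have hall : ∀ θ : ℝ, ∀ t < 0, ∀ x : ℝ³, rotZ θ (V t (rotZ (-θ) x)) = V t x := by
    intro θ t ht x
    have h := stub_rotationOrbitIncrement V C 0 hm hK0 θ t ht x
    rw [zero_mul, zero_mul] at h
    exact sub_eq_zero.1 (norm_le_zero_iff.1 h)
  refine rellichScar_axisymmetricApexFatal_proof u p G C hs hg hI hd hsing ?_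
  intro θ
  have h1 : uncurry (fun t x => rotZ θ (V t (rotZ (-θ) x)))
      =ᵐ[volume.restrict (Iio (0 : ℝ) ×ˢ (univ : Set ℝ³))] uncurry V :=
    ae_slab_of_forall (P := fun z => uncurry (fun t x => rotZ θ (V t (rotZ (-θ) x))) z = uncurry V z)
      fun t ht x => hall θ t ht x
  exact ((ae_conj_congr hae θ).symm.trans h1).trans hae

/-- **No singular apex profile has a (−1)-homogeneous scar — from linear rigidity.**  The homogeneous scar makes the
spatial dilation generator finite in the weighted norm (`stub_dilationGeneratorFlat`, landed), hence so is the scaling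
generator `z = (V + x·∇V) + 2t∂ₜV` (the package bounds `‖∂ₜV‖ ≤ L/(‖x‖+√(−t))³`); `z` solves the linearised system
(`stub_scalingGeneratorSolvesLinearised`); linear rigidity kills it; `stub_selfSimilar_of_scalingGeneratorZero` makes `V`
exactly self-similar; the profile is then a.e. self-similar and `SelfSimilarApexFatal` (Tsai 1998, landed) ends it. -/
theorem noHomogeneousScarProfile_of_linearRigidity (stub_linearRigidityAtProfile :
    (∀ (V : ℝ → ℝ³ → ℝ³) (Q : ℝ → ℝ³ → ℝ) (C : ℝ), 0 < C →
        IsTypeIAncientMild C V → HasTypeIDecay C V → IsClassicalNSSolutionOn (Iio (0 : ℝ)) 1 0 V Q →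
        ScaleInvariantBounds V Q → IsBackwardSingularPoint V 0 →
        ∀ (Z : ℝ → ℝ³ → ℝ³) (P : ℝ → ℝ³ → ℝ) (K : ℝ),
          IsSmoothSpaceTimeOn (Iio (0 : ℝ)) Z → IsSmoothSpaceTimeOn (Iio (0 : ℝ)) P →
          (∀ t < 0, VectorCalculus.IsDivFree (Z t)) →
          (∀ t < 0, ∀ x : ℝ³, deriv (fun s => Z s x) t + convect (V t) (Z t) x + convect (Z t) (V t) x =
              (Δ (Z t)) x - gradient (P t) x) →
          (∀ t < 0, ∀ x : ℝ³, ‖Z t x‖ ≤ K * ((-t) / (‖x‖ + Real.sqrt (-t)) ^ 3)) →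
          ∀ t < 0, ∀ x : ℝ³, Z t x = 0)) :
    ∀ (u : ℝ → ℝ³ → ℝ³) (p : ℝ → ℝ³ → ℝ) (G : ℝ → ℝ³ → ℝ³ →L[ℝ] ℝ³) (C : ℝ),
      IsSuitableWeakSolutionOn 𝕊 1 0 u p → HasWeakSpatialGradientOn 𝕊 u G →
      typeIBound (Iio (0 : ℝ) ×ˢ univ) u p G < ⊤ → HasTypeIDecay C u → IsBackwardSingularPoint u 0 →
      (∀ lam : ℝ, 0 < lam → SameScar (nsRescale lam u) u) → False := by
  intro u p G C hs hg hI hd hsing hhom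
  have hC : 0 < C := pos_const_of_apexSingular hd hsing
  obtain ⟨V, hae, hm, hdV⟩ := stub_apexMildRepresentative u p G C hC hs hg hI hd
  obtain ⟨Q, hcl, hB⟩ := stub_apexRegularity V C hC hm hdV
  have hsV : IsBackwardSingularPoint V 0 := isBackwardSingularPoint_congr_ae hae hsing
  have hsm : IsSmoothSpaceTimeOn (Iio (0 : ℝ)) V := hm.contDiffOn
  have hhomV : ∀ lam : ℝ, 0 < lam → SameScar (nsRescale lam V) V := fun lam hlam =>
    sameScar_congr_ae (ae_nsRescale_congr hae hlam) hae (hhom lam hlam)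
  -- the scaling generator is in X
  obtain ⟨K, hK⟩ := stub_dilationGeneratorFlat V Q C hC hm hdV hcl hB hhomV
  obtain ⟨L, hL⟩ := hB 0
  have hdt : ∀ s < (0 : ℝ), ∀ y : ℝ³, ‖deriv (fun σ => V σ y) s‖ ≤ L / (‖y‖ + Real.sqrt (-s)) ^ 3 := by
    intro s hs y
    have h := (hL s hs y).2.2
    rw [deriv_iteratedFDeriv_slice hsm isOpen_Iio 0 hs y, norm_iteratedFDeriv_zero] at h
    simpa using h
  have hzX : ∀ t < 0, ∀ x : ℝ³,
      ‖V t x + fderiv ℝ (V t) x x + (2 * t) • deriv (fun s => V s x) t‖ ≤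
        (K + 2 * L) * ((-t) / (‖x‖ + Real.sqrt (-t)) ^ 3) := by
    intro t ht x
    have hnt : 0 < -t := neg_pos.2 ht
    have hden : 0 < ‖x‖ + Real.sqrt (-t) := add_pos_of_nonneg_of_pos (norm_nonneg _) (Real.sqrt_pos.2 hnt)
    have h2 : ‖(2 * t) • deriv (fun s => V s x) t‖ ≤ 2 * L * ((-t) / (‖x‖ + Real.sqrt (-t)) ^ 3) := by
      rw [norm_smul, Real.norm_eq_abs, abs_mul, abs_of_neg ht, abs_two]
      calc 2 * -t * ‖deriv (fun s => V s x) t‖ ≤ 2 * -t * (L / (‖x‖ + Real.sqrt (-t)) ^ 3) :=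
            mul_le_mul_of_nonneg_left (hdt t ht x) (by linarith)
        _ = 2 * L * ((-t) / (‖x‖ + Real.sqrt (-t)) ^ 3) := by ring
    calc ‖V t x + fderiv ℝ (V t) x x + (2 * t) • deriv (fun s => V s x) t‖
        ≤ ‖V t x + fderiv ℝ (V t) x x‖ + ‖(2 * t) • deriv (fun s => V s x) t‖ := norm_add_le _ _
      _ ≤ K * ((-t) / (‖x‖ + Real.sqrt (-t)) ^ 3) + 2 * L * ((-t) / (‖x‖ + Real.sqrt (-t)) ^ 3) :=
          add_le_add (hK t ht x) h2
      _ = (K + 2 * L) * ((-t) / (‖x‖ + Real.sqrt (-t)) ^ 3) := by ring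
  -- it solves the linearised system, hence vanishes; so V is exactly self-similar
  obtain ⟨hZs, hPs, hdiv, heq⟩ := stub_scalingGeneratorSolvesLinearised V Q hcl
  have hz0 := stub_linearRigidityAtProfile V Q C hC hm hdV hcl hB hsV _ _ (K + 2 * L) hZs hPs hdiv heq hzX
  have hall := stub_selfSimilar_of_scalingGeneratorZero V C hm hz0
  refine rellichScar_selfSimilarApexFatal_proof u p G C hs hg hI hd hsing ?_
  intro lam hlam
  have hssV : uncurry (nsRescale lam V) =ᵐ[volume.restrict (Iio (0 : ℝ) ×ˢ (univ : Set ℝ³))] uncurry V :=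
    ae_slab_of_forall (P := fun z => uncurry (nsRescale lam V) z = uncurry V z) fun t ht x => hall lam hlam t ht x
  exact ae_selfSimilar_of_ae_eq hae.symm hlam hssV

/-- **The crux from `SymmetricScarExists` and linear rigidity.**  If `ScarRigidity` failed, a singular apex profile would exist
(`exists_singular_apex_of_not_scarRigidity`); `SymmetricScarExists` (item 11718, hypothesis) upgrades it to one with a
homogeneous or axisymmetric scar, and the two theorems above exclude both. -/
theorem scarRigidity_of_symmetricScarExists_of_linearRigidity (stub_symmetricScarExists : SymmetricScarExists)
    (stub_linearRigidityAtProfile :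
    (∀ (V : ℝ → ℝ³ → ℝ³) (Q : ℝ → ℝ³ → ℝ) (C : ℝ), 0 < C →
        IsTypeIAncientMild C V → HasTypeIDecay C V → IsClassicalNSSolutionOn (Iio (0 : ℝ)) 1 0 V Q →
        ScaleInvariantBounds V Q → IsBackwardSingularPoint V 0 →
        ∀ (Z : ℝ → ℝ³ → ℝ³) (P : ℝ → ℝ³ → ℝ) (K : ℝ),
          IsSmoothSpaceTimeOn (Iio (0 : ℝ)) Z → IsSmoothSpaceTimeOn (Iio (0 : ℝ)) P →
          (∀ t < 0, VectorCalculus.IsDivFree (Z t)) →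
          (∀ t < 0, ∀ x : ℝ³, deriv (fun s => Z s x) t + convect (V t) (Z t) x + convect (Z t) (V t) x =
              (Δ (Z t)) x - gradient (P t) x) →
          (∀ t < 0, ∀ x : ℝ³, ‖Z t x‖ ≤ K * ((-t) / (‖x‖ + Real.sqrt (-t)) ^ 3)) →
          ∀ t < 0, ∀ x : ℝ³, Z t x = 0)) :
    ScarRigidity := by
  by_contra h
  obtain ⟨C, u, p, G, _, hs, hg, hI, hd, hsing⟩ := exists_singular_apex_of_not_scarRigidity h
  obtain ⟨C', z, pz, Gz, hsz, hgz, hIz, hdz, hsingz, hsym⟩ :=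
    stub_symmetricScarExists C ⟨u, p, G, hs, hg, hI, hd, hsing⟩
  rcases hsym with hhom | hax
  · exact noHomogeneousScarProfile_of_linearRigidity stub_linearRigidityAtProfile z pz Gz C' hsz hgz hIz hdz hsingz hhom
  · exact noAxisymmetricScarProfile_of_linearRigidity stub_linearRigidityAtProfile z pz Gz C' hsz hgz hIz hdz hsingz hax

/-- **Registered tools stub of the linear reduction** (`stub_linearRigidityReduction`): LR ⇒ no homogeneous-scar profile,
LR ⇒ no axisymmetric-scar profile, `SymmetricScarExists` ∧ LR ⇒ `ScarRigidity`, in one conjunction. -/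
theorem stub_linearRigidityReduction :
    ((∀ (V : ℝ → ℝ³ → ℝ³) (Q : ℝ → ℝ³ → ℝ) (C : ℝ), 0 < C →
      IsTypeIAncientMild C V → HasTypeIDecay C V → IsClassicalNSSolutionOn (Iio (0 : ℝ)) 1 0 V Q →
      ScaleInvariantBounds V Q → IsBackwardSingularPoint V 0 →
      ∀ (Z : ℝ → ℝ³ → ℝ³) (P : ℝ → ℝ³ → ℝ) (K : ℝ),
        IsSmoothSpaceTimeOn (Iio (0 : ℝ)) Z → IsSmoothSpaceTimeOn (Iio (0 : ℝ)) P →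
        (∀ t < 0, VectorCalculus.IsDivFree (Z t)) →
        (∀ t < 0, ∀ x : ℝ³, deriv (fun s => Z s x) t + convect (V t) (Z t) x + convect (Z t) (V t) x =
            (Δ (Z t)) x - gradient (P t) x) →
        (∀ t < 0, ∀ x : ℝ³, ‖Z t x‖ ≤ K * ((-t) / (‖x‖ + Real.sqrt (-t)) ^ 3)) →
        ∀ t < 0, ∀ x : ℝ³, Z t x = 0) →
      (∀ (u : ℝ → ℝ³ → ℝ³) (p : ℝ → ℝ³ → ℝ) (G : ℝ → ℝ³ → ℝ³ →L[ℝ] ℝ³) (C : ℝ),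
      IsSuitableWeakSolutionOn 𝕊 1 0 u p → HasWeakSpatialGradientOn 𝕊 u G →
      typeIBound (Iio (0 : ℝ) ×ˢ univ) u p G < ⊤ → HasTypeIDecay C u → IsBackwardSingularPoint u 0 →
      (∀ lam : ℝ, 0 < lam → SameScar (nsRescale lam u) u) → False)) ∧
    ((∀ (V : ℝ → ℝ³ → ℝ³) (Q : ℝ → ℝ³ → ℝ) (C : ℝ), 0 < C →
      IsTypeIAncientMild C V → HasTypeIDecay C V → IsClassicalNSSolutionOn (Iio (0 : ℝ)) 1 0 V Q →
      ScaleInvariantBounds V Q → IsBackwardSingularPoint V 0 →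
      ∀ (Z : ℝ → ℝ³ → ℝ³) (P : ℝ → ℝ³ → ℝ) (K : ℝ),
        IsSmoothSpaceTimeOn (Iio (0 : ℝ)) Z → IsSmoothSpaceTimeOn (Iio (0 : ℝ)) P →
        (∀ t < 0, VectorCalculus.IsDivFree (Z t)) →
        (∀ t < 0, ∀ x : ℝ³, deriv (fun s => Z s x) t + convect (V t) (Z t) x + convect (Z t) (V t) x =
            (Δ (Z t)) x - gradient (P t) x) →
        (∀ t < 0, ∀ x : ℝ³, ‖Z t x‖ ≤ K * ((-t) / (‖x‖ + Real.sqrt (-t)) ^ 3)) →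
        ∀ t < 0, ∀ x : ℝ³, Z t x = 0) →
      (∀ (u : ℝ → ℝ³ → ℝ³) (p : ℝ → ℝ³ → ℝ) (G : ℝ → ℝ³ → ℝ³ →L[ℝ] ℝ³) (C : ℝ),
      IsSuitableWeakSolutionOn 𝕊 1 0 u p → HasWeakSpatialGradientOn 𝕊 u G →
      typeIBound (Iio (0 : ℝ) ×ˢ univ) u p G < ⊤ → HasTypeIDecay C u → IsBackwardSingularPoint u 0 →
      (∀ θ : ℝ, SameScar (fun t x => rotZ θ (u t (rotZ (-θ) x))) u) → False)) ∧
    (SymmetricScarExists → (∀ (V : ℝ → ℝ³ → ℝ³) (Q : ℝ → ℝ³ → ℝ) (C : ℝ), 0 < C →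
      IsTypeIAncientMild C V → HasTypeIDecay C V → IsClassicalNSSolutionOn (Iio (0 : ℝ)) 1 0 V Q →
      ScaleInvariantBounds V Q → IsBackwardSingularPoint V 0 →
      ∀ (Z : ℝ → ℝ³ → ℝ³) (P : ℝ → ℝ³ → ℝ) (K : ℝ),
        IsSmoothSpaceTimeOn (Iio (0 : ℝ)) Z → IsSmoothSpaceTimeOn (Iio (0 : ℝ)) P →
        (∀ t < 0, VectorCalculus.IsDivFree (Z t)) →
        (∀ t < 0, ∀ x : ℝ³, deriv (fun s => Z s x) t + convect (V t) (Z t) x + convect (Z t) (V t) x =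
            (Δ (Z t)) x - gradient (P t) x) →
        (∀ t < 0, ∀ x : ℝ³, ‖Z t x‖ ≤ K * ((-t) / (‖x‖ + Real.sqrt (-t)) ^ 3)) →
        ∀ t < 0, ∀ x : ℝ³, Z t x = 0) → ScarRigidity) :=
  ⟨noHomogeneousScarProfile_of_linearRigidity, noAxisymmetricScarProfile_of_linearRigidity,
    scarRigidity_of_symmetricScarExists_of_linearRigidity⟩

end Summit.NavierStokesRegularity.NavierStokesRegularity.Theorems.RellichScarScarRigidity

end
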